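import Literature.Probability.RandomPlanarGeometry.SLESixHullLocalityNbhdAE2
import Literature.Probability.RandomPlanarGeometry.SLEThrHorizonProofs
import Literature.Probability.RandomPlanarGeometry.LoewnerThrTipIdentity
import Literature.Probability.RandomPlanarGeometry.SLEThrImageBMAE
import Literature.Probability.RandomPlanarGeometry.SLEThrYMod
import Literature.Probability.RandomPlanarGeometry.SLESixLocalityOfHullNbhd
import Literature.Probability.RandomPlanarGeometry.SLESixHullLocalityFact
import HarnessLib

/-!
# Locality of chordal SLE₆ (restriction form, typed `IsLocal`): PROVED

Topic `Probability/RandomPlanarGeometry` (crux `stmt-CriticalPhenomena-0698`, stub `stub_isLocal` of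
line `germ-label-transport`). The last input of the locality of SLE₆ — the neighbourhood half-plane form
`sle_six_hull_locality_nbhd` (Lawler–Schramm–Werner (2001) Thm. 2.2, curve form; Lawler (2005)
Thm. 6.13: the image chain passes through the finitely many swallow instants) — assembled from the
landed pieces of the through-swallow programme: the a.s. assembly `sle_six_hull_locality_nbhd_of_thr_ae'`,
the tip identity `Loewner.thr_apply_clockC_eq_of_isGeneratedByCurve` (w-thrtip), the horizon
`thrHorizon 6 A δ` with its properties (w-horizon, `SLEThrHorizonProofs.lean`), the stochastic gluing
through a progressive modification `thrYMod` (w-glue, `SLEThrYMod.lean`) and the a.s. DDS packaging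
`exists_thr_image_brownian_of_hasMartingaleClock_ae`. Consequences: `IsSLELaw.locality_six`
(discharging the named fact of `SLESixLocality.lean`) and `ChordalFamily.IsLocal` for every family of
chordal SLE₆ laws.
-/

noncomputable section

open Set Filter Topology Function Complex Metric MeasureTheory ProbabilityTheory
open scoped NNReal ENNReal

namespace Literature.Probability.RandomPlanarGeometry

open Literature.Probability.Process Loewner

/-- **Locality of chordal SLE₆ with respect to a bounded hull, neighbourhood half-plane form, HOLDS**
([LSW 2001] Thm. 2.2; Lawler (2005) Thm. 6.13). [cite: LawlerSchrammWerner2001, Thm 2.2] -/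
theorem sle_six_hull_locality_nbhd_holds : sle_six_hull_locality_nbhd := by
  refine sle_six_hull_locality_nbhd_of_thr_ae'
    (fun hW hW0 hA hne _ _ hβ hcl _ _ hγ hno _ hU' hag _ hγ' ↦
      thr_apply_clockC_eq_of_isGeneratedByCurve hW hW0 hA hne hβ hcl hγ hno hU' hag hγ') ?_
  intro A hA hne δ hδ
  have h68 : (6 : ℝ≥0) ≠ 8 := by norm_num
  have hρ : 0 < thrRadius A δ := thrRadius_pos hA hne hδ
  set H : ℕ → (ℝ≥0 → ℝ) → WithTop ℝ≥0 := thrHorizon 6 A δ with hHdef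
  have hclw_lt : ∀ (N : ℕ) (ω : ℝ≥0 → ℝ) (t : ℝ≥0), (t : WithTop ℝ≥0) < H N ω → ∀ a ∈ A,
      deltaCluster A (thrRadius A δ) a ⊆ closedHull (drvK 6 (brownianCPath ω)) t ∨
        Disjoint (deltaCluster A (thrRadius A δ) a) (closedHull (drvK 6 (brownianCPath ω)) t) :=
    fun N ω t ht a ha ↦ deltaCluster_subset_closedHull_or_disjoint_of_coe_lt_thrHorizon hA hne hδ ht ha
  have hclw_ae : ∀ N : ℕ, ∀ᵐ ω ∂preWienerMeasure, ∀ t : ℝ≥0, (t : WithTop ℝ≥0) ≤ H N ω → ∀ a ∈ A,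
      deltaCluster A (thrRadius A δ) a ⊆ closedHull (drvK 6 (brownianCPath ω)) t ∨
        Disjoint (deltaCluster A (thrRadius A δ) a) (closedHull (drvK 6 (brownianCPath ω)) t) := by
    intro N
    filter_upwards [ae_deltaCluster_subset_closedHull_or_disjoint hA hne hδ h68] with ω hω t ht
    exact hω N t ht
  refine ⟨H, isStoppingTime_thrHorizon hA hne hδ, thrHorizon_ne_top, ?_, ?_, ?_, ?_⟩
  · filter_upwards [ae_isClosed_remHull_of_coe_le_thrHorizon hA hne hδ h68] with ω hω N T₀ hT
    exact ⟨fun t ht ↦ hω N t (by rw [show thrHorizon 6 A δ N ω = H N ω from rfl, hT]; exact WithTop.coe_le_coe.2 ht),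
      finite_image_remHull_of_thrHorizon_eq hA hne hδ hT⟩
  · exact Eventually.of_forall fun ω N t ht ↦ sleTrace_notMem_of_coe_le_thrHorizon hA hne hδ ht
  · exact Eventually.of_forall fun ω S₁ hS₁ hlt ↦ eventually_coe_lt_thrHorizon hA hne hδ ω hS₁ hlt
  · intro N
    have hHt : ∀ ω, H N ω ≠ ⊤ := fun ω ↦ thrHorizon_ne_top N ω
    obtain ⟨C, hclock⟩ := hasMartingaleClock_thrYMod hA hρ (H N) N ((N : ℝ≥0) + 1)
      (isStoppingTime_thrHorizon hA hne hδ N) (thrHorizon_le_capTimeK N) (thrHorizon_le_succ N)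
      (hclw_lt N) (hclw_ae N)
    exact exists_thr_image_brownian_of_hasMartingaleClock_ae A (isStoppingTime_thrHorizon hA hne hδ N)
      (thrHorizon_le_succ N) hclock (isStronglyProgressive_thrYMod hA hρ (isStoppingTime_thrHorizon hA hne hδ N))
      (ae_continuous_thrYMod hA hρ hHt (hclw_ae N)) (thrYMod_zero hA hρ (H N))
      (by
        filter_upwards [ae_thrYMod_eq hA hρ (hclw_ae N)] with ω hω t ht
        rw [hω t, stoppedProcess_eq_of_le ht])
      (adapted_thrClockProc_of_lt hA hρ (isStoppingTime_thrHorizon hA hne hδ N) hHt (hclw_lt N))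
      (fun ω ↦ integrableOn_thrClockRate_untopD_of_lt hA hρ (hHt ω) (hclw_lt N ω))

/-- **The curve-hitting half-plane locality implies the neighbourhood form** (already in the tree); here
the converse direction is not needed: the Jordan reduction consumes the neighbourhood form. -/
example : sle_six_hull_locality → sle_six_hull_locality_nbhd := sle_six_hull_locality_nbhd_of

/-- **`IsSLELaw.locality_six` HOLDS** — the restriction form of the locality of chordal SLE₆
([LSW 2001] Thm. 2.2 and Cor. 2.4) for Dobrushin subdomains with the same marked points: discharges the
named fact of `SLESixLocality.lean`. [cite: LawlerSchrammWerner2001, Cor 2.4] -/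
theorem IsSLELaw.locality_six_holds : IsSLELaw.locality_six :=
  IsSLELaw.locality_six_of_hull_nbhd sle_six_hull_locality_nbhd_holds

/-- **Every family of chordal SLE₆ laws on Dobrushin domains is LOCAL** (`ChordalFamily.IsLocal`).
[cite: LawlerSchrammWerner2001, Cor 2.4] -/
theorem ChordalFamily.isLocal_of_isSLELaw_six_holds {Q : ChordalFamily}
    (hQ : ∀ D : DobrushinDomain, IsSLELaw 6 D (Q D)) : Q.IsLocal :=
  ChordalFamily.isLocal_of_isSLELaw_six IsSLELaw.locality_six_holds hQ

end Literature.Probability.RandomPlanarGeometry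

end
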